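import Mathlib

/-!
# `WeightedInvariant.LocalWeightedDrop`, line `cone-game-restriction-rank`: slice order

Route `ResolutionOfSingularities/WeightedInvariant`, crux `LocalWeightedDrop`
(stmt-ResolutionOfSingularities-8899), stub `stub_sliceOrder` of the lead's skeleton
`work/LocalWeightedDrop.lean`, PROVED here (statement verbatim from the ledger registration).

**Statement (SLICE ORDER).** A successor germ `g` lives in
`k[[s, y₁, …, yₙ]] = MvPowerSeries (Fin (n+1)) k` (`s = X 0` the exceptional variable,
`yᵢ = X i.succ`).  Its restriction to the exceptional divisor `s = 0` is the `n`-variable slice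
`g(0,·) := (β ↦ coeff (Finsupp.cons 0 β) g)` (a multivariate power series IS its coefficient
function, so this lambda is a series and `coeff β g(0,·) = coeff (cons 0 β) g` definitionally).
Then (i) `ord g ≤ ord g(0,·)` and (ii) `s ∤ g ↔ g(0,·) ≠ 0`.

**Proof.** (i) By `MvPowerSeries.le_order` it suffices that `coeff β g(0,·) = 0` whenever
`degree β < ord g`; but `coeff β g(0,·) = coeff (cons 0 β) g` and
`degree (cons 0 β) = 0 + degree β = degree β` (`degree_cons`: expand both degrees as sums over
`Fin (n+1)` resp. `Fin n` and split off the `0`-th summand), so this is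
`MvPowerSeries.coeff_of_lt_order`.
(ii) By `MvPowerSeries.X_dvd_iff`, `s ∣ g` iff `coeff m g = 0` for every exponent `m` with
`m 0 = 0`; such an `m` is `cons 0 (tail m)` (`Finsupp.cons_tail`), so `s ∣ g` iff every
`coeff (cons 0 β) g` vanishes iff `g(0,·) = 0` (`MvPowerSeries.ext_iff`); negate both sides.
-/

set_option linter.dupNamespace false -- mandated namespace of this single-conjunct summit

namespace Summit.ResolutionOfSingularities.ResolutionOfSingularities.Theorems

/-- The degree of a `Finsupp.cons` exponent vector: `degree (cons e m) = e + degree m`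
(split the sum over `Fin (n+1)` at `0`). -/
private theorem degree_cons {n : ℕ} (e : ℕ) (m : Fin n →₀ ℕ) :
    (Finsupp.cons e m).degree = e + m.degree := by
  rw [Finsupp.degree_eq_sum, Finsupp.degree_eq_sum, Fin.sum_univ_succ, Finsupp.cons_zero]
  simp only [Finsupp.cons_succ]

/-- SLICE ORDER, stub `stub_sliceOrder` of the line `cone-game-restriction-rank` of crux
`LocalWeightedDrop` (stmt-ResolutionOfSingularities-8899).  For `g : k[[s, y₁, …, yₙ]]`
(`s = X 0`) and its `s⁰`-slice `g(0,·) = (β ↦ coeff (cons 0 β) g) : k[[y₁, …, yₙ]]`: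
`ord g ≤ ord g(0,·)`, and `s ∤ g` iff `g(0,·) ≠ 0`. -/
theorem stub_sliceOrder : ∀ (k : Type) [Field k] (n : ℕ) (g : MvPowerSeries (Fin (n + 1)) k),
    g.order ≤ MvPowerSeries.order
      (show MvPowerSeries (Fin n) k from fun β => MvPowerSeries.coeff (Finsupp.cons 0 β) g) ∧
    (¬ (MvPowerSeries.X (0 : Fin (n + 1)) ∣ g) ↔
      (show MvPowerSeries (Fin n) k from fun β => MvPowerSeries.coeff (Finsupp.cons 0 β) g) ≠ 0) := by
  intro k _ n g
  refine ⟨?_, ?_⟩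
  · -- (i) a slice monomial `y^β` of degree `< ord g` is the monomial `s⁰ y^β` of `g`, same degree
    refine MvPowerSeries.le_order fun β hβ => ?_
    show MvPowerSeries.coeff (Finsupp.cons 0 β) g = 0
    refine MvPowerSeries.coeff_of_lt_order ?_
    rwa [degree_cons, zero_add]
  · -- (ii) `s ∣ g` iff all `s`-free coefficients of `g` vanish iff the slice is `0`
    refine not_congr ?_
    rw [MvPowerSeries.X_dvd_iff, MvPowerSeries.ext_iff]
    constructor
    · intro h β
      rw [MvPowerSeries.coeff_zero]
      show MvPowerSeries.coeff (Finsupp.cons 0 β) g = 0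
      exact h _ (Finsupp.cons_zero _ _)
    · intro h m hm
      have hβ := h (Finsupp.tail m)
      rw [MvPowerSeries.coeff_zero] at hβ
      change MvPowerSeries.coeff (Finsupp.cons 0 (Finsupp.tail m)) g = 0 at hβ
      rwa [← hm, Finsupp.cons_tail] at hβ

end Summit.ResolutionOfSingularities.ResolutionOfSingularities.Theorems
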